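import Summits.RiemannHypothesis.RiemannHypothesis.Theorems.SemilocalWindowMarkov
import HarnessLib

/-!
# Semi-local thresholds, negative side, at ANY finite set of primes (II): the certificate `WeilNegCertS`

Cell `rh-explicit` (HOME `run/shared/lean/pub/rh-explicit/`), seat cc-s2-4 gen7 (A4 SEMILOCAL-TABLE, the Lean side;
design note `HOME/cc-s2-2/a4/NEGCERT-S-DESIGN.md`, cc-s2-2 gen4).  Honest framing: theorems about the tree's
`weilSemilocalThreshold S`; nothing here bears on RH.  No data is trusted: soundness consumes only `c.check c₀ = true`
and a PROVED enclosure predicate for the atoms.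

The certificate `WeilNegCertS = (p, b; nA, mA, KA; Kt, nt; ne; atoms, logSuccLo)` is `WeilNegCert0`
(`SemilocalNegCertEmpty.lean`) plus a LIST of atoms `(n, lo, hi, wlo, whi)` — rational enclosures `lo ≤ log n ≤ hi`,
`wlo ≤ Λ_S(n)/√n ≤ whi` — and a rational `logSuccLo ≤ log (N+1)`.  `check` (pure `ℚ`/`Bool`, `decide`-able) verifies
`0 < lo ≤ hi ≤ 2b` per atom, `2b < logSuccLo`, the side conditions of `WeilNegCert0`, and the STRICT INEQUALITY

  `Σ_atoms whi·U_[lo,hi] + A + 2N·T < (c₀ + 2 Σ_atoms wlo)·N + 2m²`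

with `U_[lo,hi] ≥ D` on `[lo, hi]` (`evalUpperQ`), `A ≥ ∫₀^{2b} w·D` (`archMajorL`), `T ≥ ∫_{2b}^∞ w` (`archTailQ`),
`N = ‖G‖²`, `m ≤ |Ĝ(1)|` (`mellinOneLowerQ`), `c₀` any proved lower bound of `C_∅`.  SOUNDNESS
(`weilSemilocalThreshold_le_of_checkS`): `AtomsEnclose S N c.atoms c.logSuccLo → c₀ ≤ C_∅ → c.check c₀ = true →
a*(S) ≤ c.b`, through the window criterion of `SemilocalWindowMarkov.lean`.  The enclosure predicate is proved ONCE per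
`(S, N)` (a handful of `log`/`√` inequalities); the instances (`S = {2,3}` past `(log 5)/2`: atoms `2, 3, 4`;
`S = {2,3,5}` past `(log 7)/2`: atoms `2, 3, 4, 5`) live in their own files.  Scope: `b ≤ 1` (the archimedean
majorant is used on `(0, 2b] ⊆ (0, 2]`).  Folklore throughout.
-/

set_option autoImplicit false
set_option linter.dupNamespace false  -- the mandated namespace repeats `RiemannHypothesis`

noncomputable section

/-! ## The certificate `WeilNegCertS`, its checker, soundness -/

namespace Summit.RiemannHypothesis.RiemannHypothesis.Theorems.SemilocalPolyWitness

open MeasureTheory Set Finset Real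
open Literature.NumberTheory.LFunctions
open Summit.RiemannHypothesis.RiemannHypothesis.Theorems.MotivicDoor
open Summit.RiemannHypothesis.RiemannHypothesis.Theorems.MotivicDoor.SemilocalThreshold
open Summit.RiemannHypothesis.RiemannHypothesis.Theorems.MotivicDoor.SemilocalMarkov
open LQ

/-! ### The weights `Λ_S(n)/√n` at prime powers (for the per-`(S, N)` enclosure proofs) -/

/-- `Λ_S(p^m)/√(p^m) = log p/√(p^m)` for a prime `p ∈ S`, `m ≥ 1`. -/
theorem weilSemilocalCoeff_pow_of_mem {S : Finset ℕ} {p m : ℕ} (hp : p.Prime) (hm : m ≠ 0) (h : p ∈ S) :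
    weilSemilocalCoeff S (p ^ m) = Real.log p / Real.sqrt ((p ^ m : ℕ) : ℝ) := by
  unfold weilSemilocalCoeff
  rw [Nat.primeFactors_prime_pow hm hp, if_pos (Finset.singleton_subset_iff.2 h),
    ArithmeticFunction.vonMangoldt_apply_pow hm, ArithmeticFunction.vonMangoldt_apply_prime hp]

/-- `Λ_S(p)/√p = log p/√p` for a prime `p ∈ S`. -/
theorem weilSemilocalCoeff_prime_of_mem {S : Finset ℕ} {p : ℕ} (hp : p.Prime) (h : p ∈ S) :
    weilSemilocalCoeff S p = Real.log p / Real.sqrt p := by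
  have h1 := weilSemilocalCoeff_pow_of_mem (m := 1) hp one_ne_zero h
  rwa [pow_one] at h1

/-- `Λ_S(p^m) = 0` for a prime `p ∉ S`. -/
theorem weilSemilocalCoeff_pow_of_not_mem {S : Finset ℕ} {p m : ℕ} (hp : p.Prime) (hm : m ≠ 0) (h : p ∉ S) :
    weilSemilocalCoeff S (p ^ m) = 0 := by
  unfold weilSemilocalCoeff
  rw [Nat.primeFactors_prime_pow hm hp, if_neg (fun hs ↦ h (Finset.singleton_subset_iff.1 hs))]

/-- `Λ_S(p) = 0` for a prime `p ∉ S`. -/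
theorem weilSemilocalCoeff_prime_of_not_mem {S : Finset ℕ} {p : ℕ} (hp : p.Prime) (h : p ∉ S) :
    weilSemilocalCoeff S p = 0 := by
  have h1 := weilSemilocalCoeff_pow_of_not_mem (m := 1) hp one_ne_zero h
  rwa [pow_one] at h1

/-! ### The certificate -/

/-- Rational enclosure data of one atom `n` of the `S`-local prime sum: `lo ≤ log n ≤ hi` and
`wlo ≤ Λ_S(n)/√n ≤ whi`. -/
structure AtomQ where
  /-- lower bound of `log n` -/
  lo : ℚ
  /-- upper bound of `log n` -/
  hi : ℚ
  /-- lower bound of the weight `Λ_S(n)/√n` -/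
  wlo : ℚ
  /-- upper bound of the weight `Λ_S(n)/√n` -/
  whi : ℚ

/-- **The atom table encloses `(S, N)`**: the listed `n` are distinct and `≤ N`, every other `n ≤ N` has
`Λ_S(n) = 0`, the rational data enclose `log n` and `Λ_S(n)/√n`, and `logSuccLo ≤ log (N+1)`.  Proved once per
`(S, N)`; the checker never sees `S`.  (A bookkeeping predicate of this certificate format, not a cited fact.) [folklore] -/
structure AtomsEnclose (S : Finset ℕ) (N : ℕ) (atoms : List (ℕ × AtomQ)) (logSuccLo : ℚ) : Prop where
  /-- the atoms are distinct -/
  nodup : (atoms.map Prod.fst).Nodup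
  /-- the atoms lie in the window's index range -/
  lt_succ : ∀ na ∈ atoms, na.1 < N + 1
  /-- every other index carries no weight -/
  cover : ∀ n ∈ Finset.range (N + 1), n ∉ atoms.map Prod.fst → weilSemilocalCoeff S n = 0
  /-- the rational data enclose `log n` and `Λ_S(n)/√n` -/
  encl : ∀ na ∈ atoms, (na.2.lo : ℝ) ≤ Real.log na.1 ∧ Real.log na.1 ≤ (na.2.hi : ℝ) ∧
    (na.2.wlo : ℝ) ≤ weilSemilocalCoeff S na.1 ∧ weilSemilocalCoeff S na.1 ≤ (na.2.whi : ℝ)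
  /-- `logSuccLo ≤ log (N+1)` -/
  logSucc : (logSuccLo : ℝ) ≤ Real.log ((N : ℝ) + 1)

/-- The rational atom side `Σ_atoms whi · U_[lo,hi](inc)` (`U` = `evalUpperQ` of the increment list on `[lo, hi]`). -/
def atomLhsQ (inc : List ℚ) : List (ℕ × AtomQ) → ℚ
  | [] => 0
  | na :: rest => na.2.whi * evalUpperQ inc na.2.lo (na.2.hi - na.2.lo) + atomLhsQ inc rest

/-- `Σ_atoms wlo`. -/
def atomWloSum : List (ℕ × AtomQ) → ℚ
  | [] => 0
  | na :: rest => na.2.wlo + atomWloSum rest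

/-- The rational side conditions on the atoms: `0 < lo ≤ hi ≤ T` (`T = 2b`). -/
def atomsOk (T : ℚ) : List (ℕ × AtomQ) → Bool
  | [] => true
  | na :: rest => decide (0 < na.2.lo) && decide (na.2.lo ≤ na.2.hi) && decide (na.2.hi ≤ T) && atomsOk T rest

/-- A finite-set sum over `range (N+1)` supported on the atoms is the list sum over the atoms. -/
theorem sum_range_eq_atoms_sum {N : ℕ} {atoms : List (ℕ × AtomQ)} {h : ℕ → ℝ}
    (hnodup : (atoms.map Prod.fst).Nodup) (hsub : ∀ na ∈ atoms, na.1 < N + 1)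
    (hcover : ∀ n ∈ Finset.range (N + 1), n ∉ atoms.map Prod.fst → h n = 0) :
    ∑ n ∈ Finset.range (N + 1), h n = (atoms.map fun na ↦ h na.1).sum := by
  classical
  have e : (atoms.map fun na ↦ h na.1) = (atoms.map Prod.fst).map h := by rw [List.map_map]; rfl
  rw [e, ← List.sum_toFinset _ hnodup]
  symm
  refine Finset.sum_subset (fun n hn ↦ ?_) (fun n hn hnot ↦ hcover n hn fun hmem ↦ hnot (List.mem_toFinset.2 hmem))
  rw [List.mem_toFinset, List.mem_map] at hn
  obtain ⟨na, hna, rfl⟩ := hn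
  exact Finset.mem_range.2 (hsub na hna)

/-- The atom energy of a function whose increments on the atoms are bounded by `U` is at most `atomLhsQ`. -/
theorem atoms_sum_le_atomLhsQ {S : Finset ℕ} (inc : List ℚ) {D : ℝ → ℝ} :
    ∀ atoms : List (ℕ × AtomQ),
      (∀ na ∈ atoms, weilSemilocalCoeff S na.1 ≤ (na.2.whi : ℝ)) →
      (∀ na ∈ atoms, 0 ≤ D (Real.log na.1) ∧
        D (Real.log na.1) ≤ (evalUpperQ inc na.2.lo (na.2.hi - na.2.lo) : ℝ)) →
      (atoms.map fun na ↦ weilSemilocalCoeff S na.1 * D (Real.log na.1)).sum ≤ (atomLhsQ inc atoms : ℝ)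
  | [], _, _ => by simp [atomLhsQ]
  | na :: rest, hw, hD => by
      simp only [List.map_cons, List.sum_cons, atomLhsQ]
      push_cast
      have h1 : weilSemilocalCoeff S na.1 * D (Real.log na.1) ≤
          (na.2.whi : ℝ) * evalUpperQ inc na.2.lo (na.2.hi - na.2.lo) :=
        mul_le_mul (hw na (by simp)) (hD na (by simp)).2 (hD na (by simp)).1
          ((weilSemilocalCoeff_nonneg S na.1).trans (hw na (by simp)))
      have h2 := atoms_sum_le_atomLhsQ inc rest (fun x hx ↦ hw x (by simp [hx])) (fun x hx ↦ hD x (by simp [hx]))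
      linarith

/-- `atomWloSum ≤ Σ_atoms Λ_S(n)/√n`. -/
theorem atomWloSum_le {S : Finset ℕ} :
    ∀ atoms : List (ℕ × AtomQ), (∀ na ∈ atoms, (na.2.wlo : ℝ) ≤ weilSemilocalCoeff S na.1) →
      (atomWloSum atoms : ℝ) ≤ (atoms.map fun na ↦ weilSemilocalCoeff S na.1).sum
  | [], _ => by simp [atomWloSum]
  | na :: rest, hw => by
      simp only [List.map_cons, List.sum_cons, atomWloSum]
      push_cast
      have h1 := hw na (by simp)
      have h2 := atomWloSum_le rest (fun x hx ↦ hw x (by simp [hx]))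
      linarith

/-- Unpacking `atomsOk`. -/
theorem atomsOk_iff (T : ℚ) :
    ∀ atoms : List (ℕ × AtomQ),
      atomsOk T atoms = true ↔ ∀ na ∈ atoms, 0 < na.2.lo ∧ na.2.lo ≤ na.2.hi ∧ na.2.hi ≤ T
  | [] => by simp [atomsOk]
  | na :: rest => by
      simp only [atomsOk, Bool.and_eq_true, decide_eq_true_eq, List.forall_mem_cons, atomsOk_iff T rest]
      tauto

/-- A negative certificate for the `S`-threshold on a window: an odd polynomial witness, enclosure orders, and the
rational atom table (= `WeilNegCert0` plus atoms). -/
structure WeilNegCertS where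
  /-- coefficients (in powers of `x`) of the odd polynomial `p`; the witness is `p·1_{[−b,b]}` -/
  p : List ℚ
  /-- the window half-width (`a*(S) ≤ b` is the conclusion) -/
  b : ℚ
  /-- order of the `exp` majorant in `archMajorL` (`≥ 1`) -/
  nA : ℕ
  /-- half the number of geometric terms in `archMajorL` -/
  mA : ℕ
  /-- order of the `sinh` minorant in `archMajorL` -/
  KA : ℕ
  /-- number of explicit tail exponentials -/
  Kt : ℕ
  /-- order of the partial `exp` sums bounding `e^{−x}` (`≥ 1`) -/
  nt : ℕ
  /-- order of the Maclaurin polynomial in the polar moment (`≥ 1`) -/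
  ne : ℕ
  /-- the atoms `(n, lo, hi, wlo, whi)` -/
  atoms : List (ℕ × AtomQ)
  /-- a rational lower bound of `log (N+1)` (the window is `b < (log (N+1))/2`) -/
  logSuccLo : ℚ

namespace WeilNegCertS

variable (c : WeilNegCertS)

/-- `q = D/t` as a list (the increment list without its vanishing constant coefficient). -/
def q : List ℚ := (incrementL c.p c.b).tail

/-- Upper bound of the left side `Σ_atoms (Λ_S(n)/√n) D_{log n} + ∫₀^∞ w·D` (atoms + bulk majorant + tail). -/
def lhsQ : ℚ :=
  atomLhsQ (incrementL c.p c.b) c.atoms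
    + evQ (integ (mul (archMajorL c.nA c.mA c.KA) c.q)) (2 * c.b)
    + 2 * LQ.normSq c.p c.b * archTailQ (2 * c.b) c.Kt c.nt

/-- Lower bound of the right side `C_{S,N}‖G‖² + 2|Ĝ(1)|²`, given a lower bound `c₀ ≤ C_∅`. -/
def rhsQ (c0 : ℚ) : ℚ := (c0 + 2 * atomWloSum c.atoms) * LQ.normSq c.p c.b + 2 * mellinOneLowerQ c.p c.b c.ne ^ 2

/-- **The checker.** -/
def check (c0 : ℚ) : Bool :=
  isOddList c.p && decide (0 < c.b) && decide (c.b ≤ 1) &&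
    decide (0 < c.nA) && decide (0 < c.nt) && decide (0 < c.ne) &&
    decide ((incrementL c.p c.b).headD 0 = 0) && decide (invPartialExpQ c.nt (2 * (2 * c.b)) < 1) &&
    atomsOk (2 * c.b) c.atoms && decide (2 * c.b < c.logSuccLo) && decide (c.lhsQ < c.rhsQ c0)

end WeilNegCertS

/-- **SOUNDNESS of `WeilNegCertS`.**  If the atom table encloses `(S, N)` and the checker accepts `c` against a proved
lower bound `c₀ ≤ C_∅`, then `a*(S) ≤ c.b`. -/
theorem weilSemilocalThreshold_le_of_checkS (c : WeilNegCertS) {S : Finset ℕ} {N : ℕ} {c0 : ℚ}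
    (henc : AtomsEnclose S N c.atoms c.logSuccLo) (hc0 : (c0 : ℝ) ≤ semilocalEmptyConstant)
    (h : c.check c0 = true) : weilSemilocalThreshold S ≤ (c.b : ℝ) := by
  -- unpack the checker and the enclosure
  simp only [WeilNegCertS.check, Bool.and_eq_true, decide_eq_true_eq] at h
  obtain ⟨⟨⟨⟨⟨⟨⟨⟨⟨⟨hodd, hb0⟩, hb1⟩, hnA⟩, hnt⟩, hne⟩, hhead⟩, htail1⟩, hatoms⟩, hsucc⟩, hmain⟩ := h
  rw [atomsOk_iff] at hatoms
  obtain ⟨hnodup, hsub, hcover, hencl, hlogSucc⟩ := henc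
  set p := c.p
  set b := c.b
  have hb0' : (0 : ℝ) < b := by exact_mod_cast hb0
  have hb2' : ((2 * b : ℚ) : ℝ) ≤ 2 := by
    have h2 : 2 * b ≤ (2 : ℚ) := by linarith
    exact_mod_cast h2
  have hbwin : (b : ℝ) < Real.log ((N : ℝ) + 1) / 2 := by
    have h1 : ((2 * b : ℚ) : ℝ) < c.logSuccLo := by exact_mod_cast hsucc
    push_cast at h1
    linarith
  set G := polyWitness p b with hG
  have hW := isMarkovWitness_polyWitness (p := p) (b := b) hodd hb0
  set inc := incrementL p b
  set Nm : ℝ := (LQ.normSq p b : ℝ)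
  have hN : ∫ x, ‖G x‖ ^ 2 = Nm := integral_norm_sq_polyWitness (p := p) hb0
  have hN0 : 0 ≤ Nm := by rw [← hN]; exact integral_nonneg fun x ↦ by positivity
  -- D on (0, 2b]: D(t) = ev inc t = t · ev q t, q ≥ 0
  have hDev : ∀ t ∈ Set.Ioc (0 : ℝ) ((2 * b : ℚ) : ℝ), weilIncrement G t = ev inc t := fun t ht ↦
    weilIncrement_polyWitness_eq_ev hodd hb0 ht.1.le (by push_cast at ht; exact ht.2)
  have hDq : ∀ t ∈ Set.Ioc (0 : ℝ) ((2 * b : ℚ) : ℝ), weilIncrement G t = t * ev c.q t := fun t ht ↦ by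
    rw [hDev t ht, ev_eq_headD_add_tail, hhead]
    push_cast
    rw [zero_add]
    rfl
  have hq : ∀ t ∈ Set.Ioc (0 : ℝ) ((2 * b : ℚ) : ℝ), 0 ≤ ev c.q t := fun t ht ↦ by
    have h1 := weilIncrement_nonneg G t
    rw [hDq t ht] at h1
    exact (mul_nonneg_iff_of_pos_left ht.1).1 h1
  -- atoms
  have hAt : semilocalAtomEnergy S N G ≤ (atomLhsQ inc c.atoms : ℝ) := by
    unfold semilocalAtomEnergy
    rw [sum_range_eq_atoms_sum (h := fun n ↦ weilSemilocalCoeff S n * weilIncrement G (Real.log n)) hnodup hsub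
      (fun n hn hnot ↦ by rw [hcover n hn hnot, zero_mul])]
    refine atoms_sum_le_atomLhsQ inc c.atoms (fun na hna ↦ (hencl na hna).2.2.2) (fun na hna ↦ ?_)
    obtain ⟨hlo0, _, hhiT⟩ := hatoms na hna
    obtain ⟨hlo, hhi, _, _⟩ := hencl na hna
    have hmem : Real.log na.1 ∈ Set.Ioc (0 : ℝ) ((2 * b : ℚ) : ℝ) :=
      ⟨lt_of_lt_of_le (by exact_mod_cast hlo0) hlo, hhi.trans (by exact_mod_cast hhiT)⟩
    refine ⟨weilIncrement_nonneg G _, ?_⟩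
    rw [hDev _ hmem]
    exact ev_le_evalUpperQ inc hlo (by push_cast; linarith)
  -- bulk
  obtain ⟨hintA, hA⟩ := setIntegral_weilArchDensity_mul_le (D := weilIncrement G) (by positivity) hb2' hDq hq
    c.nA c.mA c.KA hnA
  -- tail
  have h2b0 : (0 : ℚ) < 2 * b := by positivity
  obtain ⟨hintW, _⟩ := setIntegral_Ioi_weilArchDensity_le c.Kt (c := ((2 * b : ℚ) : ℝ)) (by exact_mod_cast h2b0)
  have hT := setIntegral_Ioi_weilArchDensity_le_archTailQ c.Kt hnt h2b0 htail1
  have hDtail : EqOn (fun t ↦ weilArchDensity t * weilIncrement G t) (fun t ↦ 2 * Nm * weilArchDensity t)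
      (Set.Ioi ((2 * b : ℚ) : ℝ)) := fun t ht ↦ by
    simp only
    rw [weilIncrement_polyWitness_eq_of_lt hodd hb0 (by push_cast at ht; exact ht)]
    ring
  have hintW' : IntegrableOn (fun t ↦ 2 * Nm * weilArchDensity t) (Set.Ioi ((2 * b : ℚ) : ℝ)) :=
    hintW.const_mul (2 * Nm)
  have hintT : IntegrableOn (fun t ↦ weilArchDensity t * weilIncrement G t) (Set.Ioi ((2 * b : ℚ) : ℝ)) :=
    hintW'.congr_fun hDtail.symm measurableSet_Ioi
  have hTail : ∫ t in Set.Ioi ((2 * b : ℚ) : ℝ), weilArchDensity t * weilIncrement G t ≤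
      2 * Nm * archTailQ (2 * b) c.Kt c.nt := by
    rw [setIntegral_congr_fun measurableSet_Ioi hDtail, integral_const_mul]
    exact mul_le_mul_of_nonneg_left hT (by positivity)
  -- the whole half-line
  have hunion : Set.Ioc (0 : ℝ) ((2 * b : ℚ) : ℝ) ∪ Set.Ioi ((2 * b : ℚ) : ℝ) = Set.Ioi (0 : ℝ) :=
    Set.Ioc_union_Ioi_eq_Ioi (by exact_mod_cast h2b0.le)
  have hfin : IntegrableOn (fun t ↦ weilArchDensity t * weilIncrement G t) (Set.Ioi (0 : ℝ)) := by
    rw [← hunion]; exact hintA.union hintT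
  have hInt : ∫ t in Set.Ioi (0 : ℝ), weilArchDensity t * weilIncrement G t
      ≤ (evQ (integ (mul (archMajorL c.nA c.mA c.KA) c.q)) (2 * b) : ℝ) + 2 * Nm * archTailQ (2 * b) c.Kt c.nt := by
    rw [← hunion, setIntegral_union Ioc_disjoint_Ioi_same measurableSet_Ioi hintA hintT]
    exact add_le_add hA hTail
  -- the polar moment
  have hm := mellinOneLowerQ_le_norm (p := p) hne hb0 (by exact_mod_cast hb1.trans (by norm_num : (1:ℚ) ≤ 2))
  have hm0 : (0 : ℝ) ≤ mellinOneLowerQ p b c.ne := by rw [mellinOneLowerQ]; push_cast; exact le_max_right _ _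
  have hpol : (mellinOneLowerQ p b c.ne : ℝ) ^ 2 ≤ ‖weilMellin G 1‖ ^ 2 := pow_le_pow_left₀ hm0 hm 2
  -- the constant
  have hCS : (c0 : ℝ) + 2 * atomWloSum c.atoms ≤ semilocalWindowConstant S N := by
    unfold semilocalWindowConstant semilocalCoeffSum
    rw [sum_range_eq_atoms_sum (h := fun n ↦ weilSemilocalCoeff S n) hnodup hsub hcover]
    have hw := atomWloSum_le c.atoms (fun na hna ↦ (hencl na hna).2.2.1)
    linarith
  -- assemble the strict inequality
  have hmain' : (c.lhsQ : ℝ) < c.rhsQ c0 := by exact_mod_cast hmain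
  have hlhs : semilocalAtomEnergy S N G + ∫ t in Set.Ioi (0 : ℝ), weilArchDensity t * weilIncrement G t ≤
      (c.lhsQ : ℝ) := by
    rw [WeilNegCertS.lhsQ]; push_cast; linarith
  have hrhs : (c.rhsQ c0 : ℝ) ≤ semilocalWindowConstant S N * (∫ x, ‖G x‖ ^ 2) + 2 * ‖weilMellin G 1‖ ^ 2 := by
    rw [WeilNegCertS.rhsQ, hN]; push_cast
    have : ((c0 : ℝ) + 2 * atomWloSum c.atoms) * Nm ≤ semilocalWindowConstant S N * Nm :=
      mul_le_mul_of_nonneg_right hCS hN0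
    linarith
  have hlt : semilocalAtomEnergy S N G + (∫ t in Set.Ioi (0 : ℝ), weilArchDensity t * weilIncrement G t) <
      semilocalWindowConstant S N * (∫ x, ‖G x‖ ^ 2) + 2 * ‖weilMellin G 1‖ ^ 2 :=
    lt_of_le_of_lt hlhs (hmain'.trans_le hrhs)
  exact weilSemilocalThreshold_le_of_markovWitness_window S N hW hfin hlt hbwin

/-- Soundness with the sharp constant `c0SharpQ` (`SemilocalNegCertEmpty.lean`):
`AtomsEnclose S N c.atoms c.logSuccLo → c.check c0SharpQ = true → a*(S) ≤ c.b`. -/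
theorem weilSemilocalThreshold_le_of_checkS_sharp (c : WeilNegCertS) {S : Finset ℕ} {N : ℕ}
    (henc : AtomsEnclose S N c.atoms c.logSuccLo) (h : c.check c0SharpQ = true) :
    weilSemilocalThreshold S ≤ (c.b : ℝ) :=
  weilSemilocalThreshold_le_of_checkS c henc c0SharpQ_le h

end Summit.RiemannHypothesis.RiemannHypothesis.Theorems.SemilocalPolyWitness

end
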